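import Literature.NumberTheory.EllipticCurves.Pal2012.QuadraticTwistPeriodProofs
import Literature.NumberTheory.EllipticCurves.ImaginaryPeriod
import Literature.NumberTheory.EllipticCurves.ManinConstantQuadraticTwistAtTwoProofs
import Literature.NumberTheory.EllipticCurves.GrossZagierRationalPointPeriodProofs
import HarnessLib

/-!
# Road (C) `disegni-pair-two` on crux stmt-BirchSwinnertonDyer-20368 — the PERIOD INPUT `Ω(W)·τ(χ)·x = l·Ω^±_f`
# is RATIONAL, with `l` explicit (Pal's archimedean step + Gauss-sum squares)

Cell `bsd-print-cf2` (`run/shared/lean/pub/bsd-print-cf2/`), width seat `bsd-line-cf2-p1-w8` g23; supplies the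
hypothesis `hl` of `shaAn_bookkeeping_of_generator` / `shaAn_valuation_chi8` / `shaAn_valuation_chi4` /
`shaAn_valuation_chi8'` (`PrintCf2DisegniPairTwoShaAnBookkeeping[Odd].lean`). `--supports stmt-BirchSwinnertonDyer-20368`
(helper). THEOREMS ONLY (no `def`, no named fact, no `sorry`); conditional on every displayed hypothesis. BSD is
not proved by any of this; no summit statement is claimed; 20368 is not closed here.

## What is proved

For the member `W` of class `d*` (ANY model with `C • W = V^{(d*)}`, `V` the good curve with newform `f`) the
period input of the `shaAn` bookkeeping is a RATIONAL multiple of the newform period, with the multiple EXPLICIT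
up to sign — so its `2`-adic valuation (the class constant of the defect key) is read off `u(C)`, the number of
real components `c_∞(V)` and the newform period ratio of `V`:

* §1 `gaussSum_chi8_eq_or` (`τ(χ₈) = ±2√2`), `gaussSum_chi4_mul_I_eq_or` (`τ(χ₋₄)·i = ±2`),
  `gaussSum_chi8'_mul_I_eq_or` (`τ(χ₋₈)·i = ±2√2`) — from the tree's `g(χ)² = 8, −4, −8`.
* §2 ★★ `exists_periodInput_chi8` (`d* = 2`): given the plus period ratio `ϖ·Ω(V) = Ω⁺_f` (`ϖ ∈ ℚ^×`; by name from a
  modular parametrisation datum, `ModularParametrizationData.exists_rat_mul_realPeriodRat_eq_plusPeriod`):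
  `∃ s = ±1, Ω(W)·τ(χ₈) = l·Ω⁺_f` with `l = 2s/(|u(C)|·ϖ)` (Pal: `Ω(W)·√2 = |u(C⁻¹)|·Ω(V)`).
* §3 ★★ `exists_periodInput_chi4` (`d* = −1`) and ★★ `exists_periodInput_chi8'` (`d* = −2`): given the minus period
  ratio `μ·Ω⁻(V) = Ω⁻_f` (`μ ∈ ℚ^×`; by name from `ModularParametrizationData.exists_int_maninConstant_mul_minusPeriod_eq`):
  `∃ s = ±1, Ω(W)·(τ(χ)·i) = l·Ω⁻_f` with `l = 2s·c_∞(V)/(|u(C)|·μ)` (Pal: `Ω(W)·√|d*| = |u(C⁻¹)|·c_∞(V)·Ω⁻(V)`).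

References: V. Pal, Proc. AMS 140 (2012) Lemma 3.1, Thm. 3.2 [Pal2012]; H. L. Montgomery, R. C. Vaughan,
Multiplicative Number Theory I (2007) Thm. 9.17 [MontgomeryVaughan2007]; B. Edixhoven, Progr. Math. 89 (1991) §1
[EdixhovenManin1991]; J. E. Cremona, Algorithms for Modular Elliptic Curves (1997) §2.8 [CremonaAlgorithms1997].
-/

set_option autoImplicit false
set_option linter.dupNamespace false

noncomputable section

open scoped Classical MatrixGroups ModularForm

open CongruenceSubgroup WeierstrassCurve Literature.NumberTheory.EllipticCurves
  Literature.NumberTheory.EllipticCurves.ModularForms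

namespace Summit.BirchSwinnertonDyer.BirchSwinnertonDyer.Theorems.PrintCf2.DisegniPairTwo

/-! ### §1 The Gauss sums up to sign -/

section Gauss

/-- `(√2 : ℂ)² = 2`. [folklore] -/
private theorem sqrt_two_sq : ((Real.sqrt 2 : ℝ) : ℂ) ^ 2 = 2 := by
  rw [← Complex.ofReal_pow, Real.sq_sqrt (by norm_num : (0 : ℝ) ≤ 2)]; norm_num

/-- **`τ(χ₈) = ±2√2`** (from `g(χ₈)² = 8`, Montgomery–Vaughan Thm. 9.17).
[cite: MontgomeryVaughan2007, Thm. 9.17 (PDF p. 232)] -/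
theorem gaussSum_chi8_eq_or :
    ∃ s : ℤˣ, gaussSum (ZMod.χ₈.ringHomComp (Int.castRingHom ℂ)) (ZMod.stdAddChar (N := 8)) =
      ((s : ℤ) : ℂ) * 2 * ((Real.sqrt 2 : ℝ) : ℂ) := by
  have hsq : gaussSum (ZMod.χ₈.ringHomComp (Int.castRingHom ℂ)) (ZMod.stdAddChar (N := 8)) ^ 2 =
      (2 * ((Real.sqrt 2 : ℝ) : ℂ)) ^ 2 := by
    rw [gaussSum_χ₈_ringHomComp_sq, mul_pow, sqrt_two_sq]; norm_num
  rcases sq_eq_sq_iff_eq_or_eq_neg.mp hsq with h | h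
  · exact ⟨1, by rw [h]; push_cast; ring⟩
  · exact ⟨-1, by rw [h]; push_cast; ring⟩

/-- **`τ(χ₋₄)·i = ±2`** (from `g(χ₋₄)² = −4`). [cite: MontgomeryVaughan2007, Thm. 9.17 (PDF p. 232)] -/
theorem gaussSum_chi4_mul_I_eq_or :
    ∃ s : ℤˣ, gaussSum (ZMod.χ₄.ringHomComp (Int.castRingHom ℂ) : DirichletCharacter ℂ (2 ^ 2))
        (ZMod.stdAddChar (N := 2 ^ 2)) * Complex.I = ((s : ℤ) : ℂ) * 2 := by
  have h4 : gaussSum (ZMod.χ₄.ringHomComp (Int.castRingHom ℂ) : DirichletCharacter ℂ (2 ^ 2))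
      (ZMod.stdAddChar (N := 2 ^ 2)) ^ 2 = -4 := gaussSum_χ₄_ringHomComp_sq
  have hsq : (gaussSum (ZMod.χ₄.ringHomComp (Int.castRingHom ℂ) : DirichletCharacter ℂ (2 ^ 2))
      (ZMod.stdAddChar (N := 2 ^ 2)) * Complex.I) ^ 2 = (2 : ℂ) ^ 2 := by
    rw [mul_pow, h4, Complex.I_sq]; norm_num
  rcases sq_eq_sq_iff_eq_or_eq_neg.mp hsq with h | h
  · exact ⟨1, by rw [h]; push_cast; ring⟩
  · exact ⟨-1, by rw [h]; push_cast; ring⟩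

/-- **`τ(χ₋₈)·i = ±2√2`** (from `g(χ₋₈)² = −8`). [cite: MontgomeryVaughan2007, Thm. 9.17 (PDF p. 232)] -/
theorem gaussSum_chi8'_mul_I_eq_or :
    ∃ s : ℤˣ, gaussSum (ZMod.χ₈'.ringHomComp (Int.castRingHom ℂ) : DirichletCharacter ℂ (2 ^ (2 + 1)))
        (ZMod.stdAddChar (N := 2 ^ (2 + 1))) * Complex.I = ((s : ℤ) : ℂ) * 2 * ((Real.sqrt 2 : ℝ) : ℂ) := by
  have h8 : gaussSum (ZMod.χ₈'.ringHomComp (Int.castRingHom ℂ) : DirichletCharacter ℂ (2 ^ (2 + 1)))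
      (ZMod.stdAddChar (N := 2 ^ (2 + 1))) ^ 2 = -8 := gaussSum_χ₈'_ringHomComp_sq
  have hsq : (gaussSum (ZMod.χ₈'.ringHomComp (Int.castRingHom ℂ) : DirichletCharacter ℂ (2 ^ (2 + 1)))
      (ZMod.stdAddChar (N := 2 ^ (2 + 1))) * Complex.I) ^ 2 = (2 * ((Real.sqrt 2 : ℝ) : ℂ)) ^ 2 := by
    rw [mul_pow, h8, Complex.I_sq, mul_pow, sqrt_two_sq]; norm_num
  rcases sq_eq_sq_iff_eq_or_eq_neg.mp hsq with h | h
  · exact ⟨1, by rw [h]; push_cast; ring⟩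
  · exact ⟨-1, by rw [h]; push_cast; ring⟩

end Gauss

/-! ### §2 `d* = 2`: `Ω(W)·τ(χ₈) = l·Ω⁺_f` with `l = ±2/(|u(C)|·ϖ)` -/

section Plus

/-- ★★ **The period input of the `χ₈∘N`-class is rational, explicitly.** `V/ℚ` elliptic, `W` ANY model of its twist
by `2` (`C • W = V^{(2)}`), `f` a cusp form with the plus period ratio `ϖ·Ω(V) = Ω⁺_f`, `ϖ ∈ ℚ^×`. Then
`Ω(W)·τ(χ₈) = l·Ω⁺_f` with `l = 2s/(|u(C)|·ϖ)` for a sign `s` (Pal's `Ω(E^d)·√d = ũ·Ω(E)`, here `ũ = |u(C⁻¹)|`,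
and `τ(χ₈) = ±2√2`); in particular `v₂(l) = 1 − v₂(u(C)) − v₂(ϖ)` is a class datum.
[cite: Pal2012, Lemma 3.1 and Thm. 3.2 (case d > 0)] [cite: EdixhovenManin1991, §1] -/
theorem exists_periodInput_chi8 (V W : WeierstrassCurve ℚ) [V.IsElliptic] [W.IsElliptic]
    {C : VariableChange ℚ} (hC : C • W = V.quadraticTwist 2) {N : ℕ} (f : CuspForm (Gamma0 N) 2)
    {ϖ : ℚ} (hϖ0 : ϖ ≠ 0) (hϖ : (ϖ : ℝ) * V.realPeriodRat = plusPeriod f) :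
    ∃ s : ℤˣ, (W.realPeriodRat : ℂ) *
        gaussSum (ZMod.χ₈.ringHomComp (Int.castRingHom ℂ)) (ZMod.stdAddChar (N := 8)) =
      (((s : ℤ) * 2 / (|(C.u : ℚ)| * ϖ) : ℚ) : ℂ) * (plusPeriod f : ℂ) := by
  -- Pal's archimedean step for the inverse change of variables `C⁻¹ • V^{(2)} = W`
  have hC' : C⁻¹ • V.quadraticTwist 2 = W := by rw [← hC, inv_smul_smul]
  have hPal := V.realPeriodRat_mul_sqrt_of_twist_of_pos (d := 2) (by norm_num) W C⁻¹ hC'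
  have hu' : ((C⁻¹.u : ℚ) : ℝ) = ((C.u : ℚ) : ℝ)⁻¹ := by
    rw [show C⁻¹.u = C.u⁻¹ from rfl, Units.val_inv_eq_inv_val, Rat.cast_inv]
  rw [hu', abs_inv, show ((2 : ℚ) : ℝ) = 2 by norm_num] at hPal
  set a : ℝ := |((C.u : ℚ) : ℝ)| with ha
  have ha0 : a ≠ 0 := abs_ne_zero.mpr (by exact_mod_cast C.u.ne_zero)
  have hϖR : (ϖ : ℝ) ≠ 0 := by exact_mod_cast hϖ0
  -- the real identity `Ω(W)·√2·|u(C)|·ϖ = Ω⁺_f`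
  have key : W.realPeriodRat * Real.sqrt 2 * (a * ϖ) = plusPeriod f := by
    rw [hPal, ← hϖ]; field_simp
  obtain ⟨s, hs⟩ := gaussSum_chi8_eq_or
  refine ⟨s, ?_⟩
  have keyC : (W.realPeriodRat : ℂ) * ((Real.sqrt 2 : ℝ) : ℂ) * ((a : ℂ) * (ϖ : ℂ)) = (plusPeriod f : ℂ) := by
    have h := congrArg (fun x : ℝ => (x : ℂ)) key
    push_cast at h
    exact h
  have haC : (a : ℂ) ≠ 0 := by exact_mod_cast ha0
  have hϖC : (ϖ : ℂ) ≠ 0 := by exact_mod_cast hϖ0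
  have habs : (((|(C.u : ℚ)| : ℚ)) : ℂ) = (a : ℂ) := by rw [ha, ← Complex.ofReal_ratCast, Rat.cast_abs]
  rw [hs]
  push_cast
  rw [habs, ← keyC]
  field_simp

end Plus

/-! ### §3 `d* = −1, −2`: `Ω(W)·(τ(χ)·i) = l·Ω⁻_f` with `l = ±2·c_∞(V)/(|u(C)|·μ)` -/

section Minus

/-- ★★ **The period input of the `χ₋₄∘N`-class (`d* = −1`) is rational, explicitly.** `V/ℚ` elliptic, `W` ANY model of
its twist by `−1` (`C • W = V^{(−1)}`), `f` a cusp form with the minus period ratio `μ·Ω⁻(V) = Ω⁻_f`, `μ ∈ ℚ^×`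
(`Ω⁻(V) = imaginaryPeriodRat V`). Then `Ω(W)·(τ(χ₋₄)·i) = l·Ω⁻_f` with `l = 2s·c_∞(V)/(|u(C)|·μ)` for a sign
`s` (Pal: `Ω(E^d)·√(−d) = ũ·c_∞·Ω⁻(E)`; `τ(χ₋₄)·i = ±2`).
[cite: Pal2012, Thm. 3.2 (case d < 0)] [cite: CremonaAlgorithms1997, §2.8] -/
theorem exists_periodInput_chi4 (V W : WeierstrassCurve ℚ) [V.IsElliptic] [W.IsElliptic]
    {C : VariableChange ℚ} (hC : C • W = V.quadraticTwist (-1)) {N : ℕ} (f : CuspForm (Gamma0 N) 2)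
    {μ : ℚ} (hμ0 : μ ≠ 0) (hμ : (μ : ℝ) * V.imaginaryPeriodRat = minusPeriod f) :
    ∃ s : ℤˣ, (W.realPeriodRat : ℂ) *
        (gaussSum (ZMod.χ₄.ringHomComp (Int.castRingHom ℂ) : DirichletCharacter ℂ (2 ^ 2))
          (ZMod.stdAddChar (N := 2 ^ 2)) * Complex.I) =
      (((s : ℤ) * 2 * ((V.baseChange ℝ).numRealComponents : ℚ) / (|(C.u : ℚ)| * μ) : ℚ) : ℂ) *
        (minusPeriod f : ℂ) := by
  have hC' : C⁻¹ • V.quadraticTwist (-1) = W := by rw [← hC, inv_smul_smul]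
  have hPal := V.realPeriodRat_mul_sqrt_of_twist_of_neg' (d := -1) (by norm_num) W C⁻¹ hC'
  have hu' : ((C⁻¹.u : ℚ) : ℝ) = ((C.u : ℚ) : ℝ)⁻¹ := by
    rw [show C⁻¹.u = C.u⁻¹ from rfl, Units.val_inv_eq_inv_val, Rat.cast_inv]
  rw [hu', abs_inv, show -(((-1 : ℚ)) : ℝ) = 1 by norm_num, Real.sqrt_one, mul_one] at hPal
  set a : ℝ := |((C.u : ℚ) : ℝ)| with ha
  set n : ℕ := (V.baseChange ℝ).numRealComponents with hn
  have ha0 : a ≠ 0 := abs_ne_zero.mpr (by exact_mod_cast C.u.ne_zero)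
  have hμR : (μ : ℝ) ≠ 0 := by exact_mod_cast hμ0
  have key : W.realPeriodRat * (a * μ) = n * minusPeriod f := by
    rw [hPal, ← hμ]; field_simp
  obtain ⟨s, hs⟩ := gaussSum_chi4_mul_I_eq_or
  refine ⟨s, ?_⟩
  have keyC : (W.realPeriodRat : ℂ) * ((a : ℂ) * (μ : ℂ)) = (n : ℂ) * (minusPeriod f : ℂ) := by
    have h := congrArg (fun x : ℝ => (x : ℂ)) key
    push_cast at h
    exact h
  have haC : (a : ℂ) ≠ 0 := by exact_mod_cast ha0
  have hμC : (μ : ℂ) ≠ 0 := by exact_mod_cast hμ0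
  have habs : (((|(C.u : ℚ)| : ℚ)) : ℂ) = (a : ℂ) := by rw [ha, ← Complex.ofReal_ratCast, Rat.cast_abs]
  rw [hs]
  push_cast
  rw [habs]
  field_simp
  linear_combination keyC

/-- ★★ **The period input of the `χ₋₈∘N`-class (`d* = −2`) is rational, explicitly.** `V/ℚ` elliptic, `W` ANY model of
its twist by `−2` (`C • W = V^{(−2)}`), `f` a cusp form with the minus period ratio `μ·Ω⁻(V) = Ω⁻_f`, `μ ∈ ℚ^×`.
Then `Ω(W)·(τ(χ₋₈)·i) = l·Ω⁻_f` with `l = 2s·c_∞(V)/(|u(C)|·μ)` for a sign `s` (Pal: `Ω(E^d)·√2 = ũ·c_∞·Ω⁻(E)`;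
`τ(χ₋₈)·i = ±2√2`). [cite: Pal2012, Thm. 3.2 (case d < 0)] [cite: CremonaAlgorithms1997, §2.8] -/
theorem exists_periodInput_chi8' (V W : WeierstrassCurve ℚ) [V.IsElliptic] [W.IsElliptic]
    {C : VariableChange ℚ} (hC : C • W = V.quadraticTwist (-2)) {N : ℕ} (f : CuspForm (Gamma0 N) 2)
    {μ : ℚ} (hμ0 : μ ≠ 0) (hμ : (μ : ℝ) * V.imaginaryPeriodRat = minusPeriod f) :
    ∃ s : ℤˣ, (W.realPeriodRat : ℂ) *
        (gaussSum (ZMod.χ₈'.ringHomComp (Int.castRingHom ℂ) : DirichletCharacter ℂ (2 ^ (2 + 1)))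
          (ZMod.stdAddChar (N := 2 ^ (2 + 1))) * Complex.I) =
      (((s : ℤ) * 2 * ((V.baseChange ℝ).numRealComponents : ℚ) / (|(C.u : ℚ)| * μ) : ℚ) : ℂ) *
        (minusPeriod f : ℂ) := by
  have hC' : C⁻¹ • V.quadraticTwist (-2) = W := by rw [← hC, inv_smul_smul]
  have hPal := V.realPeriodRat_mul_sqrt_of_twist_of_neg' (d := -2) (by norm_num) W C⁻¹ hC'
  have hu' : ((C⁻¹.u : ℚ) : ℝ) = ((C.u : ℚ) : ℝ)⁻¹ := by
    rw [show C⁻¹.u = C.u⁻¹ from rfl, Units.val_inv_eq_inv_val, Rat.cast_inv]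
  rw [hu', abs_inv, show -(((-2 : ℚ)) : ℝ) = 2 by norm_num] at hPal
  set a : ℝ := |((C.u : ℚ) : ℝ)| with ha
  set n : ℕ := (V.baseChange ℝ).numRealComponents with hn
  have ha0 : a ≠ 0 := abs_ne_zero.mpr (by exact_mod_cast C.u.ne_zero)
  have hμR : (μ : ℝ) ≠ 0 := by exact_mod_cast hμ0
  have key : W.realPeriodRat * Real.sqrt 2 * (a * μ) = n * minusPeriod f := by
    rw [hPal, ← hμ]; field_simp
  obtain ⟨s, hs⟩ := gaussSum_chi8'_mul_I_eq_or
  refine ⟨s, ?_⟩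
  have keyC : (W.realPeriodRat : ℂ) * ((Real.sqrt 2 : ℝ) : ℂ) * ((a : ℂ) * (μ : ℂ)) =
      (n : ℂ) * (minusPeriod f : ℂ) := by
    have h := congrArg (fun x : ℝ => (x : ℂ)) key
    push_cast at h
    exact h
  have haC : (a : ℂ) ≠ 0 := by exact_mod_cast ha0
  have hμC : (μ : ℂ) ≠ 0 := by exact_mod_cast hμ0
  have habs : (((|(C.u : ℚ)| : ℚ)) : ℂ) = (a : ℂ) := by rw [ha, ← Complex.ofReal_ratCast, Rat.cast_abs]
  rw [hs]
  push_cast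
  rw [habs]
  field_simp
  linear_combination keyC

end Minus

end Summit.BirchSwinnertonDyer.BirchSwinnertonDyer.Theorems.PrintCf2.DisegniPairTwo

end
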